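import Summits.QuantumFields.YangMills.Theorems.UnitScaleTiltProp7MassiveColumnBlockDecay
import Summits.QuantumFields.YangMills.Theorems.UnitScaleTiltProp7BlockConvolutionWeightedSup
import HarnessLib

/-!
# Route `UnitScaleTilt`, crux K1 «MinimiserStabilityRegPr» (stmt-QuantumFields-19200), EX row (5) `h3` (STOREY H), pipeline (ii) := «H2-LOC», C6 letter **`hPen` SUPPLIED — THE SUP OF THE
# BARE LOD PENALTY `a•T(ι(Q″g))` FROM THE SUP OF `g`** (the `hPen` binder of the knit ✓`Prop7OmegaOneAxialHolderKnit.hax_omega_one`; PIN TABLE of `LOCATE-C6-knit-px13g17.md` §3: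
# «supplier ✓`norm_equiv_penalty_apply_le_blockCut` + the one-block `L² ≤ √(c₀ℓ³)·sup`»).  The penalty is BLOCK-LOCAL: its value at a fine site `x` only sees `g` cut to the block `B(x)`
# (✓`Prop7MassiveColumnBlockDecay.norm_equiv_penalty_apply_le_blockCut`: `≤ p₂·‖𝟙_{B(x)}g‖_{L²}`), and a one-block field has `‖·‖_{L²} ≤ √(c₀ℓ³)·sup` (✓`norm_blockCut_le`); so
# `‖(a•T(ι(Q″g)))(y)‖ ≤ (p₂·√(c₀ℓ³))·sup‖g‖` for EVERY site field `g` — no propagator, no decay, K-free at the pin `c₁ = c₀ℓ³` exactly as (W1) ✓`hpenW_of_regPr` (which is the same bound for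
# `g := G_a f` only).

Cell `ym3-torus` (HUMAN RULING D-0037; rung R3 = SU(2) YM₃ on T³ — NOT d = 4, NOT infinite volume, NOT a mass gap, NOT Clay).  Width seat `ym3-torus-px13` (gen 17);
`--supports stmt-QuantumFields-19200 --as helper`; count-neutral; THEOREMS ONLY (0 `def`, 0 `sorry`, default heartbeats).

WHAT IS PROVED (ns `Summit.QuantumFields.YangMills.Theorems.Prop7PenaltySupLetter`; the LOD letters of ✓`Prop7MassiveColumnBlockDecay` VERBATIM: member `F`, `h : n ≤ K`, weights `c₀ c₁ > 0`,
`RegPr F n K ε₀ U₀` with `0 < ε₀`, `10⁷L³ε₀ ≤ 1`, the nested mean `Q″` (`hseq`), the lift `ι` (`hι`), the adjoint `T` (`hT`), `0 < a`).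
* ★★ `hPen_of_regPr` — `∀ g Gb, 0 ≤ Gb → (∀ y, ‖g y‖ ≤ Gb) → ∀ y, ‖(a•T(ι(Q″g)))(y)‖ ≤ (p₂·√(c₀(L³)^{K−n}))·Gb`, `p₂ = a·((5∕4)√(2c₁)((L³)^{K−n})⁻¹∕c₀)·√((25∕8)(c₁((L³)^{K−n})⁻¹∕c₀))` —
  the knit's `hPen` text with `Cpen := p₂·√(c₀(L³)^{K−n})`.
HYP-SAT (★★OWNER RULING №42).  The letters are the LOD family letters of record (K6∕W-files; `Q″ ι T` inhabited by the nested-mean package); the conclusion is a sup row between displayed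
terms; nothing conclusion-shaped is assumed.  HONEST SCOPE: two tree lemmas composed; nothing of `hHlocV`, `hWsup`, `hUsup`, `h3`, norm_G, EX, 19200 or the rung; the Yang–Mills mass gap is NOT proved.

References: T. Bałaban, CMP **99** (1985) 389–434 [Balaban1985BackgroundPropagators] ((3.24) p.394, Thm 3.1 (3.42) p.397, (3.49) p.399); CMP **95** (1984) 17–40 [Balaban1984PropagatorsI]
((1.18) p.20).
-/

set_option autoImplicit false

noncomputable section

open scoped BigOperators Matrix.Norms.L2Operator InnerProductSpace ComplexConjugate

namespace Summit.QuantumFields.YangMills.Theorems.Prop7PenaltySupLetter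

open Literature.MathematicalPhysics.QuantumFieldTheory.Balaban1983to89
open Literature.MathematicalPhysics.QuantumFieldTheory.Balaban1983to89.T3ContinuumYM3Torus
open T4Continuum BlockAveraging
open BlockAveraging (Idx)
open B7Prop1Explicit (disp)
open B5Eq118OneStroke (iterBlockOf)
open B10Eq27TorusAxialLog (holT transl)
open B7TransferAnalyticMean (meanCLM)
open B4Sect5Torus (TSite)
open B9Eq311L2Pairing (WL2)
open B11Eq103H1Complex (SiteL2K BondL2K)
open Summit.QuantumFields.YangMills.Theorems.Prop8Chart (emlIterU)
open T3SectALandauChart (bgUnits)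
open T3PrintedRegularMinimiser (RegPr)
open T3PrintedRegularOrbits (sites_eq)
open T3LevelShift (siteShift)
open Summit.QuantumFields.YangMills.Theorems.Prop7SectET3Transport (periodsT3 siteEquiv)
open Summit.QuantumFields.YangMills.Theorems.Prop7SectET3HilbertLetters (W₂ toL2S)
open Summit.QuantumFields.YangMills.Theorems.Prop7MassiveColumnBlockDecay (norm_equiv_penalty_apply_le_blockCut)
open Summit.QuantumFields.YangMills.Theorems.Prop7MassiveSolutionGradientSupOfRegPr (norm_blockCut_le)

variable (F : T3Family) {n K : ℕ} (h : n ≤ K) {c₀ c₁ : ℝ} [Fact (0 < c₀)] [Fact (0 < c₁)]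
  {ε₀ : ℝ} (hε₀ : 0 < ε₀) (hε7 : 10 ^ 7 * (F.L : ℝ) ^ 3 * ε₀ ≤ 1)
  (U₀ : GaugeField (F.P K) 0 (Matrix.specialUnitaryGroup (Fin 2) ℂ)) (hreg : RegPr F n K ε₀ U₀)
  (Q'' : SiteL2K ℂ 3 (periodsT3 F K) c₀ W₂ →ₗ[ℂ] (Site (F.P K) (K - n) → Matrix (Fin 2) (Fin 2) ℂ))
  (hseq : ∀ lam : Site (F.P K) 0 → Matrix (Fin 2) (Fin 2) ℂ, ∃ ns : (j : ℕ) → Site (F.P K) j → Matrix (Fin 2) (Fin 2) ℂ, ns 0 = lam ∧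
      (∀ (j : ℕ) (y : Site (F.P K) (j + 1)), ns (j + 1) y = ns j (emb y) - meanCLM (Idx (F.P K)) (Matrix (Fin 2) (Fin 2) ℂ) fun i : Idx (F.P K) =>
        ns j (emb y) - ((holT (emlIterU j (bgUnits F K U₀)) (emb y) (stairWord i.2.1 (off i.1)) : (Matrix (Fin 2) (Fin 2) ℂ)ˣ) : Matrix (Fin 2) (Fin 2) ℂ) *
          ns j (transl (emb y) (disp (stairWord i.2.1 (off i.1)))) * (((holT (emlIterU j (bgUnits F K U₀)) (emb y) (stairWord i.2.1 (off i.1)))⁻¹ : (Matrix (Fin 2) (Fin 2) ℂ)ˣ) : Matrix (Fin 2) (Fin 2) ℂ)) ∧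
      ns (K - n) = Q'' (toL2S F K c₀ lam))
  (ι : (Site (F.P K) (K - n) → Matrix (Fin 2) (Fin 2) ℂ) →ₗ[ℂ] SiteL2K ℂ 3 (periodsT3 F n) c₁ W₂)
  (hι : ∀ c, ι c = toL2S F n c₁ (fun z => c (siteShift (sites_eq F n K h) z)))
  (T : SiteL2K ℂ 3 (periodsT3 F n) c₁ W₂ →ₗ[ℂ] SiteL2K ℂ 3 (periodsT3 F K) c₀ W₂)
  (hT : ∀ (l : SiteL2K ℂ 3 (periodsT3 F K) c₀ W₂) (f : SiteL2K ℂ 3 (periodsT3 F n) c₁ W₂), ⟪ι (Q'' l), f⟫_ℂ = ⟪l, T f⟫_ℂ)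
  {a : ℝ} (ha : 0 < a)

include hε₀ hε7 hreg hseq hι hT ha in
/-- ★★ **THE `hPen` LETTER OF THE KNIT, SUPPLIED**: for every site field `g` with `‖g(y)‖ ≤ G_b` at every site, the bare LOD penalty has `‖(a•T(ι(Q″g)))(y)‖ ≤ (p₂·√(c₀(L³)^{K−n}))·G_b` at every
site — block locality of the penalty (✓`norm_equiv_penalty_apply_le_blockCut`) and the `L²` size of a one-block field (✓`norm_blockCut_le`).  At the pin `c₁ = c₀ℓ³` the constant is `a·(5∕4)√2·√(25∕8)`-class,
K-FREE. [cite: Balaban1985BackgroundPropagators, (3.24) p.394, (3.49) p.399; Balaban1984PropagatorsI, (1.18) p.20] -/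
theorem hPen_of_regPr :
    ∀ (g : SiteL2K ℂ 3 (periodsT3 F K) c₀ W₂) (Gb : ℝ), 0 ≤ Gb →
      (∀ y : TSite 3 (periodsT3 F K), ‖WL2.equiv ℂ (fun _ : TSite 3 (periodsT3 F K) => c₀) W₂ g y‖ ≤ Gb) →
      ∀ y : TSite 3 (periodsT3 F K), ‖WL2.equiv ℂ (fun _ : TSite 3 (periodsT3 F K) => c₀) W₂ ((a : ℂ) • T (ι (Q'' g))) y‖
        ≤ (a * ((5 / 4) * Real.sqrt (2 * c₁) * ((((F.P K).L : ℝ) ^ (F.P K).d) ^ (K - n))⁻¹ / c₀) *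
            Real.sqrt ((25 / 8) * (c₁ * ((((F.P K).L : ℝ) ^ (F.P K).d) ^ (K - n))⁻¹ / c₀)) *
            Real.sqrt (c₀ * ((((F.P K).L : ℝ) ^ (F.P K).d) ^ (K - n)))) * Gb := by
  intro g Gb _ hGb y
  have hc₀ : 0 < c₀ := Fact.out
  set x : Site (F.P K) 0 := (siteEquiv F K).symm y with hx
  have hy : siteEquiv F K x = y := by rw [hx, Equiv.apply_symm_apply]
  have h1 := norm_equiv_penalty_apply_le_blockCut F h hε₀ hε7 U₀ hreg Q'' hseq ι hι T hT ha g x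
  rw [hy] at h1
  have h2 := norm_blockCut_le F g (Fb := Gb) (fun x' => hGb _) (iterBlockOf (K - n) x)
  have hp0 : 0 ≤ a * ((5 / 4) * Real.sqrt (2 * c₁) * ((((F.P K).L : ℝ) ^ (F.P K).d) ^ (K - n))⁻¹ / c₀) *
      Real.sqrt ((25 / 8) * (c₁ * ((((F.P K).L : ℝ) ^ (F.P K).d) ^ (K - n))⁻¹ / c₀)) := by
    have := (F.P K).L_pos; positivity
  calc _ ≤ _ := h1
    _ ≤ a * ((5 / 4) * Real.sqrt (2 * c₁) * ((((F.P K).L : ℝ) ^ (F.P K).d) ^ (K - n))⁻¹ / c₀) *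
          Real.sqrt ((25 / 8) * (c₁ * ((((F.P K).L : ℝ) ^ (F.P K).d) ^ (K - n))⁻¹ / c₀)) *
          (Real.sqrt (c₀ * ((((F.P K).L : ℝ) ^ (F.P K).d) ^ (K - n))) * Gb) := mul_le_mul_of_nonneg_left h2 hp0
    _ = _ := by ring

end Summit.QuantumFields.YangMills.Theorems.Prop7PenaltySupLetter

end
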